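import Summits.CriticalPhenomena.CardyFormulaZ2.Theses.CardyMagicRigidity
import Literature.Probability.Percolation.CardyFormulaConformalInvariance

/-!
# Route item `SmirnovTri` (stmt-CriticalPhenomena-11206) — Smirnov's theorem on the triangular lattice

Support item of route `CardyMagicRigidity` (sub-problem `CardyFormulaZ2`):
for every conformal rectangle `R`, the critical site-percolation crossing probability
`triDomainCrossingProb R δ` on `δ𝕋` converges, as `δ → 0⁺`, to Cardy's function of the
cross-ratio of any uniformizing datum (`R.HasCrossingLimit … cardyFunction`).

The item is definitionally the Literature named fact
`Literature.Probability.Percolation.hasCrossingLimit_triDomainCrossingProb`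
(Smirnov, C. R. Acad. Sci. Paris 333 (2001), Thm. 1; Bollobás–Riordan, *Percolation* (2006),
Ch. 7 Thm. 2), which is PROVED in the tree as
`Literature.Probability.Percolation.hasCrossingLimit_triDomainCrossingProb_holds`
(`Literature/Probability/Percolation/CardyFormulaConformalInvariance.lean`). It is listed as a
route item (rather than imported by the route file) only so that the route file keeps its
loop-vocabulary import closure; this file closes it by the tree's discharge.
-/

namespace Summit.CriticalPhenomena.CardyFormulaZ2.Theorems

/-- **Smirnov's theorem (route item `SmirnovTri`, stmt-CriticalPhenomena-11206).**
For every conformal rectangle `R`, `triDomainCrossingProb R δ → cardyFunction (crossRatio x)` as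
`δ → 0⁺` for every uniformizing datum `(φ, x)` of `R`. Proof: the route decl unfolds to the
Literature fact `hasCrossingLimit_triDomainCrossingProb`, discharged in the tree by
`hasCrossingLimit_triDomainCrossingProb_holds` (Smirnov 2001, Thm. 1; Bollobás–Riordan 2006,
Ch. 7 Thm. 2). -/
theorem smirnovTri_proof :
    Summit.CriticalPhenomena.CardyFormulaZ2.Theses.CardyMagicRigidity.SmirnovTri := by
  unfold Summit.CriticalPhenomena.CardyFormulaZ2.Theses.CardyMagicRigidity.SmirnovTri
  exact Literature.Probability.Percolation.hasCrossingLimit_triDomainCrossingProb_holds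

end Summit.CriticalPhenomena.CardyFormulaZ2.Theorems
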